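import Literature.IUT.LogThetaLattice.TensorPacketsRingStructures
import Literature.IUT.LogThetaLattice.TensorPacketsProofs
import HarnessLib

/-!
# [IUTchIII] Proposition 3.1 (i), header-binder statement — proof (companion of `TensorPacketsRingStructures.lean`)

Proof-only companion (abc-iut cell, L6 companion seat abc-iut-L6-t5) of abc-iut-L6-t4's
`Literature/IUT/LogThetaLattice/TensorPacketsRingStructures.lean` (p406939), which restates
[IUTchIII] Proposition 3.1 (i) (S. Mochizuki, *Inter-universal Teichmüller theory III*, kurims
manuscript (May 2020), p. 93; claim key Mochizuki2012, DISPUTED, D-0012) at the finite level with ALL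
hypotheses in the definition header (`Prop31i_ringStructures''`, after finding G-BINDER-DROP: the
earlier primed statement lost its section-variable binders). DISCHARGED here with exactly the
parameters of the named statement, by the companion theorem `Prop31i_ringStructures_of_field`
(`TensorPacketsProofs.lean`, p406089; classical input `Literature/RingTheory/Etale/PiTensorProductField.lean`).
No new definitions.
-/

namespace Literature.IUT.LogThetaLattice

universe u v v' w

section

variable (𝕜 : Type u) [Field 𝕜] {A : Type v} [Fintype A] {Vfib : Type v'} [Fintype Vfib]
variable (L : A → Vfib → Type w) [∀ α v, Field (L α v)] [∀ α v, Algebra 𝕜 (L α v)]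
  [∀ α v, Module.Finite 𝕜 (L α v)] [∀ α v, Algebra.IsSeparable 𝕜 (L α v)]

/-- **IUTchIII:Prop3.1(i)** (p. 93), finite level, DISCHARGED for the instantiation-safe named
statement `Prop31i_ringStructures''`: for finitely many labels `α` and places `v | v_ℚ`, with every
`log(^α𝓕_v)` a finite separable field extension of `𝕜 = ℚ_{v_ℚ}`, the holomorphic tensor packet
`log(^A𝓕_{v_ℚ}) = ⊗_α ⊕_v log(^α𝓕_v)` is ring-isomorphic to a finite product of fields. (The binders of
this theorem are exactly the parameters of the named statement.) [claim: Mochizuki2012, status: disputed] -/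
theorem Prop31i_ringStructures''_holds : Prop31i_ringStructures'' 𝕜 L :=
  Prop31i_ringStructures_of_field 𝕜 L

end

end Literature.IUT.LogThetaLattice
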